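import Literature.Geometry.Symplectic.TaubesFamilyAlphaEnergy
import Literature.Geometry.Symplectic.TaubesFamilyDiracSplitting
import Literature.Geometry.GaugeTheory.SpinConnectionChartIndependence
import HarnessLib

/-!
# The splitting `ψ = α u₀ + β` of a configuration of `𝔰_J` and the Dirac equation `∂̄_aα = -∂̄_a*β`

Topic `Literature/Geometry/Symplectic`; Hutchings–Taubes (1999) §4.3–4.4 / Taubes (1995) §5 (5.3)–(5.4)
for a GIVEN configuration `(A, ψ)` of the canonical Spinᶜ structure `𝔰_J` (the tree's
`TaubesFamilyDiracSplitting` treats the forward parametrisation `(A₀ + a, αu₀ + β)`): with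
`α = ψ_{u₀}` (`alphaFun`) and `a = ½(A - A₀)` (`halfConnectionDiff`),

* `betaField cfg = ψ - α u₀` is a smooth spinor field with vanishing `u₀`-component, `ψ = αu₀ + β`
  (`spinor_eq_smul_canonicalSpinor_add_betaField`), `⟨u₀, β⟩ = 0`;
* **`D_A(αu₀) = (∇'α)·u₀`** (`dirac_smul_canonicalSpinor_eq`): Clifford multiplication of `u₀` by the
  complex covector `∇'α = dα + iaα` — from `D_{A₀}u₀ = 0`, `D_{A₀+2a} = D_{A₀} + i a·` and the Leibniz
  rule (Hutchings–Taubes (4.8)–(4.9) without the `b`-term, which `u₀` absorbs: "the torsion `b` does not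
  appear", Taubes 1994 (15));
* **the Dirac equation of a solution splits as `D_Aβ = -(∇'α)·u₀`** (`dirac_betaField_eq_of_isSolution`),
  Hutchings–Taubes (4.10) `∂̄_aα = -∂̄_a*β`.

PROVED, 0 named facts.

## References

* M. Hutchings, C. H. Taubes, *An introduction to the Seiberg–Witten equations on symplectic
  manifolds*, IAS/Park City Math. Ser. 7 (1999; AMS 2006), §4.3 (4.8)–(4.10). [HutchingsTaubes2006]
* C. H. Taubes, *The Seiberg–Witten and Gromov invariants*, Math. Res. Lett. 2 (1995) 221–238,
  §5 (5.3)–(5.4). [Taubes1995]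
-/

noncomputable section

open scoped Manifold ContDiff Topology ComplexConjugate Matrix
open Set Function Filter Complex Literature.Geometry.Kaehler Literature.Geometry.GaugeTheory Literature.Topology.FourManifolds
open Literature.Geometry.Lorentzian (PseudoRiemannianMetric)
open Literature.Topology.FourManifolds (SmoothOrientation)
open Literature.Geometry.Manifold Literature.Geometry.Manifold.DeRhamSignFour Literature.NumberTheory.Transcendental

/-! ### Two connections with the same local form at a point have the same `∇̃` and `D` there -/

namespace Literature.Geometry.GaugeTheory.SpincStructure

variable {X : Type*} [TopologicalSpace X] [ChartedSpace (EuclideanSpace ℝ (Fin 4)) X] [IsManifold (𝓡 4) ∞ X]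
  {g : PseudoRiemannianMetric (𝓡 4) ∞ (EuclideanSpace ℝ (Fin 4)) (TangentSpace (𝓡 4) : X → Type _)}
  {o : SmoothOrientation (𝓡 4) X} {ι : Type*} {𝔰 : SpincStructure g o ι} [g.HasLeviCivita]

/-- `∇̃_A` at `x` depends on `A` only through `A_i(x)`. [folklore] -/
theorem covDeriv_congr_form {A B : 𝔰.detLineBundle.Connection} {i : ι} {x : X} (hAB : A.form i x = B.form i x)
    (ψ : SpinorField 𝔰) (v : TangentSpace (𝓡 4) x) : covDeriv A ψ i x v = covDeriv B ψ i x v := by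
  simp only [covDeriv, hAB]

/-- `D_A` at `x` depends on `A` only through `A_i(x)`. [folklore] -/
theorem dirac_congr_form {A B : 𝔰.detLineBundle.Connection} {i : ι} {x : X} (hAB : A.form i x = B.form i x)
    (ψ : SpinorField 𝔰) : dirac A ψ i x = dirac B ψ i x := by
  simp only [dirac, covDeriv_congr_form hAB]

omit [IsManifold (𝓡 4) ∞ X] in
/-- `γ` of a scalar multiple of a real 1-form. [folklore] -/
theorem cliffordOneForm_smul (c : ℝ) (α : RealOneForm X) (x : X) (e : Fin 4 → TangentSpace (𝓡 4) x) :
    cliffordOneForm (c • α) x e = (c : ℂ) • cliffordOneForm α x e := by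
  simp only [cliffordOneForm, Finset.smul_sum, smul_smul]
  refine Finset.sum_congr rfl fun k _ ↦ ?_
  congr 1
  simp

omit [IsManifold (𝓡 4) ∞ X] in
/-- `γ_ℂ` is additive in the complex covector. [folklore] -/
theorem cliffordComplexOneForm_add (β β' : (x : X) → TangentSpace (𝓡 4) x → ℂ) (x : X) (e : Fin 4 → TangentSpace (𝓡 4) x) :
    cliffordComplexOneForm (fun y w ↦ β y w + β' y w) x e = cliffordComplexOneForm β x e + cliffordComplexOneForm β' x e := by
  simp [cliffordComplexOneForm, add_smul, Finset.sum_add_distrib]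

omit [IsManifold (𝓡 4) ∞ X] in
/-- `γ_ℂ` of `f · a` for a real 1-form `a` is `f γ(a)`. [folklore] -/
theorem cliffordComplexOneForm_mul_ofReal (f : X → ℂ) (α : RealOneForm X) (x : X) (e : Fin 4 → TangentSpace (𝓡 4) x) :
    cliffordComplexOneForm (fun y w ↦ f y * ((α y w : ℝ) : ℂ)) x e = f x • cliffordOneForm α x e := by
  simp only [cliffordComplexOneForm, cliffordOneForm, Finset.smul_sum, smul_smul]

end Literature.Geometry.GaugeTheory.SpincStructure

namespace Literature.Geometry.Symplectic

open Literature.Geometry.GaugeTheory.SpincStructure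

namespace AlmostComplexStructure.IsCompatibleWith

variable {N : Type} [TopologicalSpace N] [ChartedSpace (EuclideanSpace ℝ (Fin 4)) N] [IsManifold (𝓡 4) ∞ N]
  {J : AlmostComplexStructure (𝓡 4) ∞ N} {s : MForm (𝓡 4) N ℝ 2}
  (h : J.IsCompatibleWith s) (hs : IsSmoothForm s)
  (hnd : ∀ x (v : TangentSpace (𝓡 4) x), v ≠ 0 → ∃ w : TangentSpace (𝓡 4) x, s x ![v, w] ≠ 0)

/-! ### `β = ψ - αu₀` -/

/-- **`β = ψ - α u₀`**, the component of the spinor of a configuration of `𝔰_J` along `K⁻¹`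
(as a spinor field). [cite: Taubes1995, §5 (5.3)] -/
def betaField (cfg : (h.canonicalSpincStructure hs hnd).Configuration) : SpinorField (h.canonicalSpincStructure hs hnd) :=
  cfg.spinor + (fun x ↦ -h.alphaFun hs hnd cfg x) • h.canonicalSpinor hs hnd

/-- `β_i(x) = ψ_i(x) - α(x) plusUnit`. [folklore] -/
theorem betaField_toFun (cfg : (h.canonicalSpincStructure hs hnd).Configuration) (i : N) (x : N) :
    (h.betaField hs hnd cfg).toFun i x = cfg.spinor.toFun i x - h.alphaFun hs hnd cfg x • plusUnit := by
  simp [betaField, sub_eq_add_neg]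

/-- **`ψ = α u₀ + β`.** [cite: Taubes1995, §5 (5.3)] -/
theorem spinor_eq_smul_canonicalSpinor_add_betaField (cfg : (h.canonicalSpincStructure hs hnd).Configuration) :
    cfg.spinor = h.alphaFun hs hnd cfg • h.canonicalSpinor hs hnd + h.betaField hs hnd cfg := by
  ext i x a
  simp [betaField_toFun]

/-- **`β` has no `u₀`-component** (on the chart where it is read). [cite: Taubes1995, §5 (5.3)] -/
theorem betaField_toFun_inl_one (cfg : (h.canonicalSpincStructure hs hnd).Configuration) (i : N) {x : N}
    (hx : x ∈ (h.canonicalSpincStructure hs hnd).baseSet i) :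
    (h.betaField hs hnd cfg).toFun i x (Sum.inl 1) = 0 := by
  rw [betaField_toFun, Pi.sub_apply, Pi.smul_apply, plusUnit_inl_one, smul_eq_mul, mul_one, h.alphaFun_eq hs hnd cfg i hx]
  exact sub_self _

/-- The `K⁻¹`-component of `β` is that of `ψ`. [folklore] -/
@[simp] theorem betaField_toFun_inl_zero (cfg : (h.canonicalSpincStructure hs hnd).Configuration) (i x : N) :
    (h.betaField hs hnd cfg).toFun i x (Sum.inl 0) = cfg.spinor.toFun i x (Sum.inl 0) := by
  simp [betaField_toFun]

/-- The negative components of `β` are those of `ψ` (zero for a configuration). [folklore] -/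
theorem betaField_toFun_inr (cfg : (h.canonicalSpincStructure hs hnd).Configuration) (i : N) {x : N}
    (hx : x ∈ (h.canonicalSpincStructure hs hnd).baseSet i) (b : Fin 2) :
    (h.betaField hs hnd cfg).toFun i x (Sum.inr b) = 0 := by
  have hψ := congrFun ((h.canonicalSpincStructure hs hnd).toFun_eq_sumElim_plusSpinor cfg hx) (Sum.inr b)
  simp only [Sum.elim_inr, Pi.zero_apply] at hψ
  simp [betaField_toFun, hψ]

/-- **`β` is smooth.** [folklore] -/
theorem isSmooth_betaField (cfg : (h.canonicalSpincStructure hs hnd).Configuration) : (h.betaField hs hnd cfg).IsSmooth :=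
  cfg.isSmooth.add ((h.isSmooth_canonicalSpinor hs hnd).smulFun
    ((contDiff_neg.of_le le_top).comp_contMDiff (h.contMDiff_alphaFun hs hnd cfg)))

/-- **`⟨u₀, β⟩ = 0`.** [cite: Taubes1995, §5 (5.3)] -/
theorem star_plusUnit_dotProduct_betaField (cfg : (h.canonicalSpincStructure hs hnd).Configuration) (i : N) {x : N}
    (hx : x ∈ (h.canonicalSpincStructure hs hnd).baseSet i) :
    star plusUnit ⬝ᵥ (h.betaField hs hnd cfg).toFun i x = 0 := by
  rw [dotProduct, Fintype.sum_sum_type, Fin.sum_univ_two, Fin.sum_univ_two]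
  simp [h.betaField_toFun_inl_one hs hnd cfg i hx, h.betaField_toFun_inr hs hnd cfg i hx]

/-- `|β|² = |ψ₀|²` (`= betaSq` in the chart at the point). [folklore] -/
theorem star_dotProduct_betaField_self (cfg : (h.canonicalSpincStructure hs hnd).Configuration) (i : N) {x : N}
    (hx : x ∈ (h.canonicalSpincStructure hs hnd).baseSet i) :
    star ((h.betaField hs hnd cfg).toFun i x) ⬝ᵥ (h.betaField hs hnd cfg).toFun i x =
      (Complex.normSq (cfg.plusSpinor i x 0) : ℂ) := by
  rw [dotProduct, Fintype.sum_sum_type, Fin.sum_univ_two, Fin.sum_univ_two]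
  simp [h.betaField_toFun_inl_one hs hnd cfg i hx, h.betaField_toFun_inr hs hnd cfg i hx, SpincStructure.Configuration.plusSpinor,
    Complex.normSq_eq_conj_mul_self]

/-! ### `D_A(αu₀) = (∇'α)·u₀` and the split Dirac equation -/

/-- The local forms of `A` and of `A₀ + 2a`, `a = ½(A - A₀)`, agree on the chart. [folklore] -/
theorem conn_form_eq [(h.metric hs).HasLeviCivita] (cfg : (h.canonicalSpincStructure hs hnd).Configuration) (i : N) {x : N}
    (hx : x ∈ (h.canonicalSpincStructure hs hnd).baseSet i) :
    cfg.conn.form i x = ((h.taubesConnection hs hnd).addForm ((2 : ℝ) • h.halfConnectionDiff hs hnd cfg)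
      (fun y ↦ (h.smoothAt_halfConnectionDiff hs hnd cfg y).smul _)).form i x := by
  rw [(h.canonicalSpincStructure hs hnd).form_eq_add_connectionDiff cfg.conn (h.taubesConnection hs hnd) i hx]
  simp [CircleCocycle.Connection.addForm, halfConnectionDiff, smul_smul]

/-- **`D_A(αu₀) = (∇'α)·u₀`**, `∇'α = dα + iaα`, `a = ½(A - A₀)`: the Dirac operator of `A` on
`α u₀` is Clifford multiplication of `u₀` by the covariant derivative of `α` for the connection `A`
induces on the trivial summand (`D_{A₀}u₀ = 0`). [cite: HutchingsTaubes2006, §4.3 (4.8)–(4.9)]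
[cite: Taubes1995, §5 (5.4)] -/
theorem dirac_smul_canonicalSpinor_eq [(h.metric hs).HasLeviCivita] (hcl : IsClosedForm s)
    (cfg : (h.canonicalSpincStructure hs hnd).Configuration) (i : N) {x : N}
    (hx : x ∈ (h.canonicalSpincStructure hs hnd).baseSet i) :
    dirac cfg.conn (h.alphaFun hs hnd cfg • h.canonicalSpinor hs hnd) i x =
      cliffordComplexOneForm (fun y w ↦ connDeriv (h.alphaFun hs hnd cfg) (h.halfConnectionDiff hs hnd cfg) y w) x
        (fun k ↦ (h.canonicalSpincStructure hs hnd).frame i k x) *ᵥ plusUnit := by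
  have hα := ((h.contMDiff_alphaFun hs hnd cfg) x).mdifferentiableAt (by simp)
  -- `γ_ℂ(dα + iaα) = γ_ℂ(dα) + (iα)γ(a)`
  have hsplit : cliffordComplexOneForm (fun y w ↦ connDeriv (h.alphaFun hs hnd cfg) (h.halfConnectionDiff hs hnd cfg) y w) x
      (fun k ↦ (h.canonicalSpincStructure hs hnd).frame i k x) =
      cliffordComplexOneForm (fun y w ↦ complexDeriv (h.alphaFun hs hnd cfg) y w) x (fun k ↦ (h.canonicalSpincStructure hs hnd).frame i k x) +
        (I * h.alphaFun hs hnd cfg x) • cliffordOneForm (h.halfConnectionDiff hs hnd cfg) x (fun k ↦ (h.canonicalSpincStructure hs hnd).frame i k x) := by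
    simp only [cliffordComplexOneForm, cliffordOneForm, connDeriv, Finset.smul_sum, smul_smul, ← Finset.sum_add_distrib,
      ← add_smul]
    refine Finset.sum_congr rfl fun k _ ↦ ?_
    congr 1
    ring
  rw [SpincStructure.dirac_congr_form (h.conn_form_eq hs hnd cfg i hx),
    dirac_smul_fun _ hα (h.spinorMDiffAt_canonicalSpinor hs hnd i x), dirac_addForm,
    h.dirac_taubesConnection_canonicalSpinor_eq_zero hs hnd hcl i hx, zero_add, canonicalSpinor_toFun,
    SpincStructure.cliffordOneForm_smul, hsplit, Matrix.add_mulVec]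
  congr 1
  rw [Matrix.smul_mulVec, Matrix.smul_mulVec, smul_smul, smul_smul]
  congr 1
  push_cast
  ring

/-- **The split Dirac equation of a solution: `D_Aβ = -(∇'α)·u₀`** (Hutchings–Taubes (4.10)
`∂̄_aα = -∂̄_a*β`). [cite: HutchingsTaubes2006, §4.4 (4.10)] [cite: Taubes1995, §5 (5.4)] -/
theorem dirac_betaField_eq_of_isSolution [(h.metric hs).HasLeviCivita] (hcl : IsClosedForm s) {η : (h.canonicalSpincStructure hs hnd).Perturbation}
    {cfg : (h.canonicalSpincStructure hs hnd).Configuration} (hsol : SpincStructure.IsSolution η cfg) (i : N) {x : N}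
    (hx : x ∈ (h.canonicalSpincStructure hs hnd).baseSet i) :
    dirac cfg.conn (h.betaField hs hnd cfg) i x =
      -(cliffordComplexOneForm (fun y w ↦ connDeriv (h.alphaFun hs hnd cfg) (h.halfConnectionDiff hs hnd cfg) y w) x
        (fun k ↦ (h.canonicalSpincStructure hs hnd).frame i k x) *ᵥ plusUnit) := by
  have hD := (hsol i x hx).2
  have hα := ((h.contMDiff_alphaFun hs hnd cfg) x).mdifferentiableAt (by simp)
  rw [h.spinor_eq_smul_canonicalSpinor_add_betaField hs hnd cfg,
    dirac_add _ (h.spinorMDiffAt_smul_canonicalSpinor hs hnd hα i) ((h.isSmooth_betaField hs hnd cfg).spinorMDiffAt hx),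
    h.dirac_smul_canonicalSpinor_eq hs hnd hcl cfg i hx] at hD
  exact eq_neg_of_add_eq_zero_right hD

end AlmostComplexStructure.IsCompatibleWith

end Literature.Geometry.Symplectic

end
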